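import Summits.FinalStateConjecture.FinalStateConjecture.Theorems.ClusterCompletenessAdiabaticMultiKerrILEDPhotonSphereGradient

/-!
# Route ClusterCompleteness — crux `AdiabaticMultiKerrILED`, line `Sketch`:
# the non-degenerate ILED away from the horizon collar (step 9b-ii)

Helper file for the crux `stmt-FinalStateConjecture-14310`
(`Summit.FinalStateConjecture.FinalStateConjecture.Theses.ClusterCompleteness.AdiabaticMultiKerrILED`),
line `Sketch`, registered stub `restFrame_ILED_awayFromHorizon` (lead c7, wave 9).

For the static tails-cut Schwarzschild zone at zero spin (rest frame, tilted leaves of slope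
`≤ 1/2`): the space-time integral of `∑_μ(∂_μΦ)²` over `(0, s] × {2M + η ≤ ‖y‖ ≤ R_z}` plus the
zeroth-order integral of `Φ²/M²` over `(0, s] × {2M < ‖y‖ ≤ R_z}` is bounded by the seven atoms of
`restFrame_ILED_photonSphere` (degenerate bulks of `Φ`, `∂₀Φ`, collar energy, leaf energies and
masses at `u = 0, s`): photon-sphere shell by `restFrame_ILED_photonSphere`, the rest of
`[2M + η, R_z]` by the designed bulk (`morawetzBulk_dominates`), the mass on `(2M, 15M/2]` by
`restFrame_zerothOrder_le` and on `[15M/2, R_z]` by the far zeroth-order coefficient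
(`zeroth_far_dominates_real`). Dafermos–Rodnianski arXiv:0811.0354, §4. [folklore]
-/

noncomputable section

set_option linter.dupNamespace false

open Set Filter Metric MeasureTheory
open scoped Topology ENNReal BigOperators
open Literature.Geometry.Lorentzian

namespace Summit.FinalStateConjecture.FinalStateConjecture.Theorems

/-- Far zeroth-order domination in real atoms: on `15M/2 ≤ r ≤ R_z` the zeroth-order coefficient
`M(r − 7M)/(4r⁵)` of the designed bulk is at least `M²/(8 R_z⁵)`, and the other three terms are
non-negative, so `φ² ≤ (8 R_z⁵ / M²) 𝔅`. [folklore] -/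
theorem zeroth_far_dominates_real {M Rz r T w S A φ : ℝ} (hM : 0 < M) (h1 : 15 * M / 2 ≤ r)
    (h2 : r ≤ Rz) (hSA : S ^ 2 ≤ r ^ 2 * A) :
    φ ^ 2 ≤ 8 * Rz ^ 5 / M ^ 2 *
      ((r - 2 * M) * M ^ 3 * (r - 3 * M) ^ 2 / (2 * r ^ 7) * T ^ 2 +
        3 * M / (20 * r ^ 2) * w ^ 2 + (r - 3 * M) ^ 2 / (8 * r ^ 3) * (A - (S / r) ^ 2) +
        (if 7 * M ≤ r then M * (r - 7 * M) / (4 * r ^ 5) else 0) * φ ^ 2) := by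
  have hr : 0 < r := by linarith
  have hRz : 0 < Rz := by linarith
  have h7 : 7 * M ≤ r := by linarith
  rw [if_pos h7]
  have hA : 0 ≤ A - (S / r) ^ 2 := by
    rw [div_pow, sub_nonneg, div_le_iff₀ (by positivity)]
    linarith
  have t1 : 0 ≤ (r - 2 * M) * M ^ 3 * (r - 3 * M) ^ 2 / (2 * r ^ 7) * T ^ 2 := by
    have : 0 ≤ r - 2 * M := by linarith
    positivity
  have t2 : 0 ≤ 3 * M / (20 * r ^ 2) * w ^ 2 := by positivity
  have t3 : 0 ≤ (r - 3 * M) ^ 2 / (8 * r ^ 3) * (A - (S / r) ^ 2) := by positivity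
  -- the zeroth coefficient is at least `M² / (8 R_z⁵)`
  have hc0 : M ^ 2 / (8 * Rz ^ 5) ≤ M * (r - 7 * M) / (4 * r ^ 5) := by
    rw [div_le_div_iff₀ (by positivity) (by positivity)]
    have hr5 : r ^ 5 ≤ Rz ^ 5 := pow_le_pow_left₀ hr.le h2 5
    have hrm : M / 2 ≤ r - 7 * M := by linarith
    have : M ^ 2 * (4 * r ^ 5) = 8 * r ^ 5 * (M * (M / 2)) := by ring
    rw [this]
    have h8 : 0 ≤ 8 * r ^ 5 := by positivity
    calc 8 * r ^ 5 * (M * (M / 2)) ≤ 8 * Rz ^ 5 * (M * (M / 2)) := by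
          apply mul_le_mul_of_nonneg_right _ (by positivity); linarith
      _ ≤ 8 * Rz ^ 5 * (M * (r - 7 * M)) := by
          apply mul_le_mul_of_nonneg_left _ (by positivity)
          exact mul_le_mul_of_nonneg_left hrm hM.le
      _ = M * (r - 7 * M) * (8 * Rz ^ 5) := by ring
  have hφ : 0 ≤ φ ^ 2 := sq_nonneg _
  have key : φ ^ 2 ≤ 8 * Rz ^ 5 / M ^ 2 * (M * (r - 7 * M) / (4 * r ^ 5) * φ ^ 2) := by
    have hpos : 0 < 8 * Rz ^ 5 / M ^ 2 := by positivity
    have h1' : 1 ≤ 8 * Rz ^ 5 / M ^ 2 * (M * (r - 7 * M) / (4 * r ^ 5)) := by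
      calc (1 : ℝ) = 8 * Rz ^ 5 / M ^ 2 * (M ^ 2 / (8 * Rz ^ 5)) := by field_simp
        _ ≤ 8 * Rz ^ 5 / M ^ 2 * (M * (r - 7 * M) / (4 * r ^ 5)) :=
            mul_le_mul_of_nonneg_left hc0 hpos.le
    calc φ ^ 2 = 1 * φ ^ 2 := (one_mul _).symm
      _ ≤ 8 * Rz ^ 5 / M ^ 2 * (M * (r - 7 * M) / (4 * r ^ 5)) * φ ^ 2 :=
          mul_le_mul_of_nonneg_right h1' hφ
      _ = 8 * Rz ^ 5 / M ^ 2 * (M * (r - 7 * M) / (4 * r ^ 5) * φ ^ 2) := by ring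
  have hK : 0 ≤ 8 * Rz ^ 5 / M ^ 2 := by positivity
  nlinarith [mul_nonneg hK t1, mul_nonneg hK t2, mul_nonneg hK t3]

set_option maxHeartbeats 400000 in
/-- **Non-degenerate ILED away from the horizon collar** (crux `AdiabaticMultiKerrILED`, line
`Sketch`, stub `restFrame_ILED_awayFromHorizon`): for `0 < η ≤ M/4` and every `R_z` there is `K`
with `∫_{(0,s]}∫_{2M+η≤‖y‖≤R_z} ∑(∂Φ)² + ∫_{(0,s]}∫_{2M<‖y‖≤R_z} Φ²/M² ≤ K·(seven atoms)` for all
admissible `F`, `Φ`, `s ≥ 0`. Dafermos–Rodnianski arXiv:0811.0354, §4. [folklore] -/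
theorem restFrame_ILED_awayFromHorizon : ∀ (M η Rz : ℝ), 0 < M → 0 < η → η ≤ M / 4 → ∃ K : NNReal, ∀ (F : E3 → ℝ) (Φ : E4 → ℝ) (s : ℝ), ContDiff ℝ 2 F → (∀ y, ‖fderiv ℝ F y‖ ≤ 2⁻¹) → ContDiff ℝ 3 Φ → (∀ x : E4, F (E4.spatial x) ≤ x 0 → 2 * M < Kerr.radius 0 x → KerrSchild.waveOperator (KerrSchild.inverseMetric (fun y ↦ Real.smoothTransition (2 - Kerr.radius 0 y / (8 * M)) * (2 * Kerr.scalarH M 0 y)) (Kerr.nullVector 0)) Φ x = 0) → 0 ≤ s → (∫⁻ u in Set.Ioc 0 s, ∫⁻ y in {y : E3 | 2 * M + η ≤ ‖y‖ ∧ ‖y‖ ≤ Rz}, ENNReal.ofReal (∑ μ : Fin 4, fderiv ℝ Φ (E4.ofTimeSpace (u + F y) y) (E4.basisVector μ) ^ 2)) + (∫⁻ u in Set.Ioc 0 s, ∫⁻ y in {y : E3 | 2 * M < ‖y‖ ∧ ‖y‖ ≤ Rz}, ENNReal.ofReal (Φ (E4.ofTimeSpace (u + F y) y) ^ 2 / M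 ^ 2)) ≤ (K : ENNReal) * ((∫⁻ u in Set.Ioc 0 s, ∫⁻ y in {y : E3 | 2 * M < ‖y‖}, ENNReal.ofReal ((fun (x : E4) ↦ (((Kerr.radius 0 x - 2 * M) * M ^ 3 * (Kerr.radius 0 x - 3 * M) ^ 2 / (2 * Kerr.radius 0 x ^ 7)) * fderiv ℝ Φ x (E4.basisVector 0) ^ 2 + (3 * M / (20 * Kerr.radius 0 x ^ 2)) * ((1 - (Real.smoothTransition (2 - Kerr.radius 0 x / (8 * M)) * (2 * Kerr.scalarH M 0 x))) * (∑ i : Fin 3, x i.succ * fderiv ℝ Φ x (E4.basisVector i.succ)) / Kerr.radius 0 x + (Real.smoothTransition (2 - Kerr.radius 0 x / (8 * M)) * (2 * Kerr.scalarH M 0 x)) * fderiv ℝ Φ x (E4.basisVector 0)) ^ 2 + ((Kerr.radius 0 x - 3 * M) ^ 2 / (8 * Kerr.radius 0 x ^ 3)) * ((∑ i : Fin 3, fderiv ℝ Φ x (E4.basisVector i.succ) ^ 2) - ((∑ i : Fin 3, x i.succ * fderiv ℝ Φ x (E4.basisVector i.succ)) / Kerr.radius 0 x) ^ 2) + (if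 7 * M ≤ Kerr.radius 0 x then M * (Kerr.radius 0 x - 7 * M) / (4 * Kerr.radius 0 x ^ 5) else 0) * Φ x ^ 2)) (E4.ofTimeSpace (u + F y) y))) + (∫⁻ u in Set.Ioc 0 s, ∫⁻ y in {y : E3 | 2 * M < ‖y‖}, ENNReal.ofReal ((fun (x : E4) ↦ (((Kerr.radius 0 x - 2 * M) * M ^ 3 * (Kerr.radius 0 x - 3 * M) ^ 2 / (2 * Kerr.radius 0 x ^ 7)) * fderiv ℝ (fun z ↦ fderiv ℝ Φ z (E4.basisVector 0)) x (E4.basisVector 0) ^ 2 + (3 * M / (20 * Kerr.radius 0 x ^ 2)) * ((1 - (Real.smoothTransition (2 - Kerr.radius 0 x / (8 * M)) * (2 * Kerr.scalarH M 0 x))) * (∑ i : Fin 3, x i.succ * fderiv ℝ (fun z ↦ fderiv ℝ Φ z (E4.basisVector 0)) x (E4.basisVector i.succ)) / Kerr.radius 0 x + (Real.smoothTransition (2 - Kerr.radius 0 x / (8 * M)) * (2 * Kerr.scalarH M 0 x)) * fderiv ℝ (fun z ↦ fderiv ℝ Φ z (E4.basisVector 0)) x (E4.basisVector 0)) ^ 2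 + ((Kerr.radius 0 x - 3 * M) ^ 2 / (8 * Kerr.radius 0 x ^ 3)) * ((∑ i : Fin 3, fderiv ℝ (fun z ↦ fderiv ℝ Φ z (E4.basisVector 0)) x (E4.basisVector i.succ) ^ 2) - ((∑ i : Fin 3, x i.succ * fderiv ℝ (fun z ↦ fderiv ℝ Φ z (E4.basisVector 0)) x (E4.basisVector i.succ)) / Kerr.radius 0 x) ^ 2) + (if 7 * M ≤ Kerr.radius 0 x then M * (Kerr.radius 0 x - 7 * M) / (4 * Kerr.radius 0 x ^ 5) else 0) * (fun z ↦ fderiv ℝ Φ z (E4.basisVector 0)) x ^ 2)) (E4.ofTimeSpace (u + F y) y))) + (∫⁻ u in Set.Ioc 0 s, ∫⁻ y in {y : E3 | 2 * M < ‖y‖ ∧ ‖y‖ < 2 * M + η}, ENNReal.ofReal (∑ μ : Fin 4, fderiv ℝ Φ (E4.ofTimeSpace (u + F y) y) (E4.basisVector μ) ^ 2)) + (∫⁻ y in {y : E3 | 2 * M < ‖y‖}, ENNReal.ofReal (∑ μ : Fin 4, fderiv ℝ Φ (E4.ofTimeSpace (0 + F y) y) (E4.basisVector μ) ^ 2)) +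 (∫⁻ y in {y : E3 | 2 * M < ‖y‖}, ENNReal.ofReal (∑ μ : Fin 4, fderiv ℝ Φ (E4.ofTimeSpace (s + F y) y) (E4.basisVector μ) ^ 2)) + (∫⁻ y in {y : E3 | 2 * M < ‖y‖ ∧ ‖y‖ ≤ 9 * M}, ENNReal.ofReal (Φ (E4.ofTimeSpace (0 + F y) y) ^ 2)) + (∫⁻ y in {y : E3 | 2 * M < ‖y‖ ∧ ‖y‖ ≤ 9 * M}, ENNReal.ofReal (Φ (E4.ofTimeSpace (s + F y) y) ^ 2))) := by
  intro M η Rz hM hη hη4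
  obtain ⟨K₉, hR9⟩ := restFrame_ILED_photonSphere M η hM hη hη4
  obtain ⟨K₀, hR0⟩ := restFrame_zerothOrder_le M hM
  obtain ⟨KP, hKP0, hP⟩ := morawetzBulk_dominates M η (max Rz (9 * M)) hM hη
  -- ### constants
  set m : ℝ≥0∞ := ENNReal.ofReal M with hm
  set m2 : ℝ≥0∞ := ENNReal.ofReal (M ^ 2) with hm2
  set mi2 : ℝ≥0∞ := ENNReal.ofReal (M ^ 2)⁻¹ with hmi2
  set kp : ℝ≥0∞ := ENNReal.ofReal KP with hkp
  set kF : ℝ≥0∞ := ENNReal.ofReal (KP * M ^ 3) with hkF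
  set kZ : ℝ≥0∞ := ENNReal.ofReal (8 * (max Rz (9 * M)) ^ 5 / M ^ 2) with hkZ
  set C9 : ℝ≥0∞ := (K₉ : ℝ≥0∞) with hC9
  set CY : ℝ≥0∞ := 1 + kp + C9 with hCY
  set CZ : ℝ≥0∞ := (K₀ : ℝ≥0∞) * (m + m + kF + m2 * (kp + CY)) with hCZ
  set Ktot : ℝ≥0∞ := (C9 + kp) + mi2 * (CZ + kZ) with hKtot
  have hKfin : Ktot ≠ ⊤ := by
    simp only [hKtot, hCZ, hCY, hC9, hm, hm2, hmi2, hkp, hkF, hkZ]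
    finiteness
  refine ⟨Ktot.toNNReal, ?_⟩
  intro F Φ s hF hdF hΦ hsol hs
  rw [ENNReal.coe_toNNReal hKfin]
  -- ### abbreviations
  set Φd : E4 → ℝ := fun z ↦ fderiv ℝ Φ z (E4.basisVector 0) with hΦd
  set L : ℝ → E3 → E4 := fun u y ↦ E4.ofTimeSpace (u + F y) y with hL
  have hΦ1 : ContDiff ℝ 1 Φ := hΦ.of_le (by norm_num)
  have hdiffΦ : ∀ x, DifferentiableAt ℝ Φ x := fun x ↦ hΦ1.differentiable one_ne_zero x
  have hrad : ∀ u y, Kerr.radius 0 (L u y) = ‖y‖ := fun u y ↦ by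
    simp only [hL, Kerr.radius_zero_left, E4.spatialNorm_ofTimeSpace]
  set DΦ : ℝ≥0∞ := ∫⁻ u in Set.Ioc 0 s, ∫⁻ y in {y : E3 | 2 * M < ‖y‖}, ENNReal.ofReal ((fun (x : E4) ↦ (((Kerr.radius 0 x - 2 * M) * M ^ 3 * (Kerr.radius 0 x - 3 * M) ^ 2 / (2 * Kerr.radius 0 x ^ 7)) * fderiv ℝ Φ x (E4.basisVector 0) ^ 2 + (3 * M / (20 * Kerr.radius 0 x ^ 2)) * ((1 - (Real.smoothTransition (2 - Kerr.radius 0 x / (8 * M)) * (2 * Kerr.scalarH M 0 x))) * (∑ i : Fin 3, x i.succ * fderiv ℝ Φ x (E4.basisVector i.succ)) / Kerr.radius 0 x + (Real.smoothTransition (2 - Kerr.radius 0 x / (8 * M)) * (2 * Kerr.scalarH M 0 x)) * fderiv ℝ Φ x (E4.basisVector 0)) ^ 2 + ((Kerr.radius 0 x - 3 * M) ^ 2 / (8 * Kerr.radius 0 x ^ 3)) * ((∑ i : Fin 3, fderiv ℝ Φ x (E4.basisVector i.succ) ^ 2) - ((∑ i : Fin 3, x i.succ * fderiv ℝ Φ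 x (E4.basisVector i.succ)) / Kerr.radius 0 x) ^ 2) + (if 7 * M ≤ Kerr.radius 0 x then M * (Kerr.radius 0 x - 7 * M) / (4 * Kerr.radius 0 x ^ 5) else 0) * Φ x ^ 2)) (E4.ofTimeSpace (u + F y) y)) with hDΦ
  set DΦd : ℝ≥0∞ := ∫⁻ u in Set.Ioc 0 s, ∫⁻ y in {y : E3 | 2 * M < ‖y‖}, ENNReal.ofReal ((fun (x : E4) ↦ (((Kerr.radius 0 x - 2 * M) * M ^ 3 * (Kerr.radius 0 x - 3 * M) ^ 2 / (2 * Kerr.radius 0 x ^ 7)) * fderiv ℝ (fun z ↦ fderiv ℝ Φ z (E4.basisVector 0)) x (E4.basisVector 0) ^ 2 + (3 * M / (20 * Kerr.radius 0 x ^ 2)) * ((1 - (Real.smoothTransition (2 - Kerr.radius 0 x / (8 * M)) * (2 * Kerr.scalarH M 0 x))) * (∑ i : Fin 3, x i.succ * fderiv ℝ (fun z ↦ fderiv ℝ Φ z (E4.basisVector 0)) x (E4.basisVector i.succ)) / Kerr.radius 0 x + (Real.smoothTransition (2 - Kerr.radius 0 x / (8 * M)) * (2 * Kerr.scalarH M 0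 x)) * fderiv ℝ (fun z ↦ fderiv ℝ Φ z (E4.basisVector 0)) x (E4.basisVector 0)) ^ 2 + ((Kerr.radius 0 x - 3 * M) ^ 2 / (8 * Kerr.radius 0 x ^ 3)) * ((∑ i : Fin 3, fderiv ℝ (fun z ↦ fderiv ℝ Φ z (E4.basisVector 0)) x (E4.basisVector i.succ) ^ 2) - ((∑ i : Fin 3, x i.succ * fderiv ℝ (fun z ↦ fderiv ℝ Φ z (E4.basisVector 0)) x (E4.basisVector i.succ)) / Kerr.radius 0 x) ^ 2) + (if 7 * M ≤ Kerr.radius 0 x then M * (Kerr.radius 0 x - 7 * M) / (4 * Kerr.radius 0 x ^ 5) else 0) * (fun z ↦ fderiv ℝ Φ z (E4.basisVector 0)) x ^ 2)) (E4.ofTimeSpace (u + F y) y)) with hDΦd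
  set COLe : ℝ≥0∞ := ∫⁻ u in Set.Ioc 0 s, ∫⁻ y in {y : E3 | 2 * M < ‖y‖ ∧ ‖y‖ < 2 * M + η}, ENNReal.ofReal (∑ μ : Fin 4, fderiv ℝ Φ (E4.ofTimeSpace (u + F y) y) (E4.basisVector μ) ^ 2) with hCOLe
  set E0 : ℝ≥0∞ := ∫⁻ y in {y : E3 | 2 * M < ‖y‖}, ENNReal.ofReal (∑ μ : Fin 4, fderiv ℝ Φ (E4.ofTimeSpace (0 + F y) y) (E4.basisVector μ) ^ 2) with hE0
  set Es : ℝ≥0∞ := ∫⁻ y in {y : E3 | 2 * M < ‖y‖}, ENNReal.ofReal (∑ μ : Fin 4, fderiv ℝ Φ (E4.ofTimeSpace (s + F y) y) (E4.basisVector μ) ^ 2) with hEs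
  set P0 : ℝ≥0∞ := ∫⁻ y in {y : E3 | 2 * M < ‖y‖ ∧ ‖y‖ ≤ 9 * M}, ENNReal.ofReal (Φ (E4.ofTimeSpace (0 + F y) y) ^ 2) with hP0
  set Ps : ℝ≥0∞ := ∫⁻ y in {y : E3 | 2 * M < ‖y‖ ∧ ‖y‖ ≤ 9 * M}, ENNReal.ofReal (Φ (E4.ofTimeSpace (s + F y) y) ^ 2) with hPs
  set RHS : ℝ≥0∞ := DΦ + DΦd + COLe + E0 + Es + P0 + Ps with hRHS
  have aDΦ : DΦ ≤ RHS := by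
    simp only [hRHS]; exact le_add_right (le_add_right (le_add_right (le_add_right (le_add_right le_self_add))))
  have aCOL : COLe ≤ RHS := by
    simp only [hRHS]; exact le_add_right (le_add_right (le_add_right (le_add_right le_add_self)))
  have aP0 : P0 ≤ RHS := by
    simp only [hRHS]; exact le_add_right le_add_self
  have aPs : Ps ≤ RHS := by
    simp only [hRHS]; exact le_add_self
  -- ### densities
  set prof : E4 → ℝ := fun x ↦ Real.smoothTransition (2 - Kerr.radius 0 x / (8 * M)) *
    (2 * Kerr.scalarH M 0 x) with hprof
  set fe : E4 → ℝ := fun x ↦ ∑ μ : Fin 4, fderiv ℝ Φ x (E4.basisVector μ) ^ 2 with hfe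
  set fg : E4 → ℝ := fun x ↦ fderiv ℝ Φ x (E4.basisVector 0) ^ 2 with hfg
  set fsq : E4 → ℝ := fun x ↦ Φ x ^ 2 with hfsq
  set fS : (E4 → ℝ) → E4 → ℝ := fun f x ↦ ∑ i : Fin 3, x i.succ * fderiv ℝ f x (E4.basisVector i.succ)
    with hfS
  set frs : (E4 → ℝ) → E4 → ℝ := fun f x ↦
    ((1 - prof x) * fS f x / Kerr.radius 0 x + prof x * fderiv ℝ f x (E4.basisVector 0)) ^ 2 with hfrs
  set fB : (E4 → ℝ) → E4 → ℝ := fun f x ↦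
    ((Kerr.radius 0 x - 2 * M) * M ^ 3 * (Kerr.radius 0 x - 3 * M) ^ 2 / (2 * Kerr.radius 0 x ^ 7)) *
      fderiv ℝ f x (E4.basisVector 0) ^ 2 +
    (3 * M / (20 * Kerr.radius 0 x ^ 2)) *
      ((1 - prof x) * fS f x / Kerr.radius 0 x + prof x * fderiv ℝ f x (E4.basisVector 0)) ^ 2 +
    ((Kerr.radius 0 x - 3 * M) ^ 2 / (8 * Kerr.radius 0 x ^ 3)) *
      ((∑ i : Fin 3, fderiv ℝ f x (E4.basisVector i.succ) ^ 2) - (fS f x / Kerr.radius 0 x) ^ 2) +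
    (if 7 * M ≤ Kerr.radius 0 x then M * (Kerr.radius 0 x - 7 * M) / (4 * Kerr.radius 0 x ^ 5) else 0) *
      f x ^ 2 with hfB
  have hcfd : Continuous (fderiv ℝ Φ) := hΦ1.continuous_fderiv one_ne_zero
  have hcapp : ∀ (v : E4), Continuous fun x ↦ fderiv ℝ Φ x v := fun v ↦
    hcfd.clm_apply continuous_const
  have hfe_c : Continuous fe := by
    simp only [hfe]; fun_prop
  have hfg_c : Continuous fg := by
    simp only [hfg]; fun_prop
  have hLc : Continuous (Function.uncurry L) := by
    simp only [hL]
    exact E4.continuous_ofTimeSpace_uncurry.comp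
      ((continuous_fst.add (hF.continuous.comp continuous_snd)).prodMk continuous_snd)
  have meas_of : ∀ {f : E4 → ℝ}, Continuous f →
      Measurable (Function.uncurry fun u y ↦ ENNReal.ofReal (f (L u y))) := fun hf ↦
    ENNReal.measurable_ofReal.comp (hf.measurable.comp hLc.measurable)
  -- ### sets
  set PS : Set E3 := {y : E3 | 5 * M / 2 ≤ ‖y‖ ∧ ‖y‖ ≤ 7 * M / 2} with hPS
  set Ω : Set E3 := {y : E3 | 2 * M < ‖y‖} with hΩ
  set Ω9 : Set E3 := {y : E3 | 2 * M < ‖y‖ ∧ ‖y‖ ≤ 9 * M} with hΩ9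
  set Zs : Set E3 := {y : E3 | 2 * M < ‖y‖ ∧ ‖y‖ ≤ 15 * M / 2} with hZs
  set FAR : Set E3 := {y : E3 | 15 * M / 2 ≤ ‖y‖ ∧ ‖y‖ ≤ 9 * M} with hFAR
  set COL : Set E3 := {y : E3 | 2 * M < ‖y‖ ∧ ‖y‖ < 2 * M + η} with hCOL
  set OFF : Set E3 := {y : E3 | 2 * M + η ≤ ‖y‖ ∧ ‖y‖ ≤ 9 * M ∧ (‖y‖ ≤ 5 * M / 2 ∨ 7 * M / 2 ≤ ‖y‖)}
    with hOFF
  set AW : Set E3 := {y : E3 | 2 * M + η ≤ ‖y‖ ∧ ‖y‖ ≤ Rz} with hAW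
  set OFFz : Set E3 := {y : E3 | 2 * M + η ≤ ‖y‖ ∧ ‖y‖ ≤ Rz ∧ (‖y‖ ≤ 5 * M / 2 ∨ 7 * M / 2 ≤ ‖y‖)}
    with hOFFz
  set ZR : Set E3 := {y : E3 | 2 * M < ‖y‖ ∧ ‖y‖ ≤ Rz} with hZR
  set FARz : Set E3 := {y : E3 | 15 * M / 2 ≤ ‖y‖ ∧ ‖y‖ ≤ Rz} with hFARz
  obtain ⟨_, _, _, _, _, sub_FAR_Ω, sub_OFF_Ω, _, sub_Ω9_Ω, _, Ω9_sub⟩ :=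
    photonSphere_shells M η hM hη hη4
  have mΩ9 : MeasurableSet Ω9 := measurableSet_norm_Ioc _ _
  have mFAR : MeasurableSet FAR := measurableSet_norm_Icc _ _
  have mFARz : MeasurableSet FARz := measurableSet_norm_Icc _ _
  have mZR : MeasurableSet ZR := measurableSet_norm_Ioc _ _
  have mCOL : MeasurableSet COL := measurableSet_norm_Ioo _ _
  have mOFFgen : ∀ (b : ℝ), MeasurableSet {y : E3 | 2 * M + η ≤ ‖y‖ ∧ ‖y‖ ≤ b ∧
      (‖y‖ ≤ 5 * M / 2 ∨ 7 * M / 2 ≤ ‖y‖)} := fun b ↦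
    (isClosed_le continuous_const continuous_norm).measurableSet.inter
      ((isClosed_le continuous_norm continuous_const).measurableSet.inter
      ((isClosed_le continuous_norm continuous_const).measurableSet.union
      (isClosed_le continuous_const continuous_norm).measurableSet))
  have mOFF : MeasurableSet OFF := mOFFgen _
  have mOFFz : MeasurableSet OFFz := mOFFgen _
  have sub_OFFz_Ω : OFFz ⊆ Ω := fun y hy ↦ by
    simp only [hOFFz, hΩ, Set.mem_setOf_eq] at hy ⊢; linarith [hy.1]
  have sub_FARz_Ω : FARz ⊆ Ω := fun y hy ↦ by
    simp only [hFARz, hΩ, Set.mem_setOf_eq] at hy ⊢; linarith [hy.1]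
  have AW_sub : AW ⊆ PS ∪ OFFz := by
    intro y hy
    simp only [hAW, hPS, hOFFz, Set.mem_union, Set.mem_setOf_eq] at hy ⊢
    by_cases h2 : 5 * M / 2 ≤ ‖y‖
    · by_cases h3 : ‖y‖ ≤ 7 * M / 2
      · exact Or.inl ⟨h2, h3⟩
      · exact Or.inr ⟨hy.1, hy.2, Or.inr (by linarith)⟩
    · exact Or.inr ⟨hy.1, hy.2, Or.inl (by linarith)⟩
  have ZR_sub : ZR ⊆ Zs ∪ FARz := by
    intro y hy
    simp only [hZR, hZs, hFARz, Set.mem_union, Set.mem_setOf_eq] at hy ⊢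
    by_cases h : ‖y‖ ≤ 15 * M / 2
    · exact Or.inl ⟨hy.1, h⟩
    · exact Or.inr ⟨by linarith, hy.2⟩
  -- ### slab notation and integrands
  set SI : Set E3 → (ℝ → E3 → ℝ≥0∞) → ℝ≥0∞ := fun S f ↦ ∫⁻ u in Set.Ioc 0 s, ∫⁻ y in S, f u y
    with hSI
  set ie : ℝ → E3 → ℝ≥0∞ := fun u y ↦ ENNReal.ofReal (fe (L u y)) with hie
  set ig : ℝ → E3 → ℝ≥0∞ := fun u y ↦ ENNReal.ofReal (fg (L u y)) with hig
  set isq : ℝ → E3 → ℝ≥0∞ := fun u y ↦ ENNReal.ofReal (fsq (L u y)) with hisq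
  set irs : ℝ → E3 → ℝ≥0∞ := fun u y ↦ ENNReal.ofReal (frs Φ (L u y)) with hirs
  set iB : ℝ → E3 → ℝ≥0∞ := fun u y ↦ ENNReal.ofReal (fB Φ (L u y)) with hiB
  have mie : Measurable (Function.uncurry ie) := meas_of hfe_c
  have mig : Measurable (Function.uncurry ig) := meas_of hfg_c
  have eDΦ : DΦ = SI Ω iB := rfl
  have eCOLe : COLe = SI COL ie := rfl
  have ofReal_le_mul : ∀ {a b c : ℝ}, 0 ≤ c → a ≤ c * b →
      ENNReal.ofReal a ≤ ENNReal.ofReal c * ENNReal.ofReal b := by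
    intro a b c hc h
    rw [← ENNReal.ofReal_mul hc]
    exact ENNReal.ofReal_le_ofReal h
  -- ### pointwise facts
  have hμ : ∀ x, 0 ≤ prof x ∧ prof x ≤ 2 * M / Kerr.radius 0 x := fun x ↦
    morawetzBulk_profile_bounds hM x
  have pw_g_le_e : ∀ x, fg x ≤ fe x := by
    intro x
    simp only [hfg, hfe]
    exact Finset.single_le_sum (f := fun μ : Fin 4 ↦ fderiv ℝ Φ x (E4.basisVector μ) ^ 2)
      (fun μ _ ↦ sq_nonneg _) (Finset.mem_univ 0)
  have hRz9 : 9 * M ≤ max Rz (9 * M) := le_max_right _ _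
  have hP1 : ∀ x, 2 * M + η ≤ Kerr.radius 0 x → Kerr.radius 0 x ≤ max Rz (9 * M) →
      (Kerr.radius 0 x ≤ 5 * M / 2 ∨ 7 * M / 2 ≤ Kerr.radius 0 x) → fe x ≤ KP * fB Φ x :=
    fun x h1 h2 h3 ↦ (hP Φ x (hdiffΦ x)).1 h1 h2 h3
  have hP2 : ∀ x, 2 * M < Kerr.radius 0 x → Kerr.radius 0 x ≤ max Rz (9 * M) → frs Φ x ≤ KP * fB Φ x :=
    fun x h1 h2 ↦ (hP Φ x (hdiffΦ x)).2.1 h1 h2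
  have hP4 : ∀ x, 15 * M / 2 ≤ Kerr.radius 0 x → Kerr.radius 0 x ≤ 9 * M → Φ x ^ 2 ≤ KP * M ^ 3 * fB Φ x :=
    fun x h1 h2 ↦ (hP Φ x (hdiffΦ x)).2.2.2 h1 h2
  have hfar : ∀ x, 15 * M / 2 ≤ Kerr.radius 0 x → Kerr.radius 0 x ≤ Rz →
      Φ x ^ 2 ≤ (8 * (max Rz (9 * M)) ^ 5 / M ^ 2) * fB Φ x := by
    intro x h1 h2
    have h := zeroth_far_dominates_real (Rz := max Rz (9 * M)) (T := fderiv ℝ Φ x (E4.basisVector 0))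
      (w := (1 - prof x) * fS Φ x / Kerr.radius 0 x + prof x * fderiv ℝ Φ x (E4.basisVector 0))
      (φ := Φ x) hM h1 (h2.trans (le_max_left _ _))
      (morawetzBulk_radial_sq_le x fun i ↦ fderiv ℝ Φ x (E4.basisVector i.succ))
    exact h
  -- ### (1) off the photon sphere up to `R_z`
  have hOFFz : SI OFFz ie ≤ kp * DΦ := by
    calc SI OFFz ie ≤ SI OFFz (fun u y ↦ kp * iB u y) := by
          refine slab_lintegral_mono_fun mOFFz fun u y hy ↦ ?_
          simp only [hOFFz, Set.mem_setOf_eq] at hy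
          have hr := hrad u y
          refine ofReal_le_mul hKP0 (hP1 _ ?_ ?_ ?_)
          · rw [hr]; exact hy.1
          · rw [hr]; exact hy.2.1.trans (le_max_left _ _)
          · rw [hr]; exact hy.2.2
      _ = kp * SI OFFz iB := slab_lintegral_const_mul _ ENNReal.ofReal_ne_top
      _ ≤ kp * DΦ := by rw [eDΦ]; exact mul_le_mul_right (slab_lintegral_mono_set iB sub_OFFz_Ω) _
  have hOFF : SI OFF ie ≤ kp * DΦ := by
    calc SI OFF ie ≤ SI OFF (fun u y ↦ kp * iB u y) := by
          refine slab_lintegral_mono_fun mOFF fun u y hy ↦ ?_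
          simp only [hOFF, Set.mem_setOf_eq] at hy
          have hr := hrad u y
          refine ofReal_le_mul hKP0 (hP1 _ ?_ ?_ ?_)
          · rw [hr]; exact hy.1
          · rw [hr]; exact hy.2.1.trans hRz9
          · rw [hr]; exact hy.2.2
      _ = kp * SI OFF iB := slab_lintegral_const_mul _ ENNReal.ofReal_ne_top
      _ ≤ kp * DΦ := by rw [eDΦ]; exact mul_le_mul_right (slab_lintegral_mono_set iB sub_OFF_Ω) _
  -- ### (2) the photon sphere (stub 9b-i)
  have h9' : SI PS ie ≤ C9 * RHS := hR9 F Φ s hF hdF hΦ hsol hs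
  -- ### (3) the gradient part of the claim
  have hgrad : SI AW ie ≤ (C9 + kp) * RHS := by
    calc SI AW ie ≤ SI (PS ∪ OFFz) ie := slab_lintegral_mono_set ie AW_sub
      _ ≤ SI PS ie + SI OFFz ie := slab_lintegral_union_le _ _ mie
      _ ≤ C9 * RHS + kp * DΦ := add_le_add h9' hOFFz
      _ ≤ C9 * RHS + kp * RHS := add_le_add le_rfl (mul_le_mul_right aDΦ _)
      _ = (C9 + kp) * RHS := by ring
  -- ### (4) zeroth order on `(2M, 15M/2]` (stub R0)
  have h0' : SI Zs isq ≤ (K₀ : ℝ≥0∞) * (m * (∫⁻ y in Ω9, isq 0 y) + m * (∫⁻ y in Ω9, isq s y) +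
      SI FAR isq + m2 * SI Ω9 (fun u y ↦ ENNReal.ofReal (frs Φ (L u y) + fg (L u y)))) :=
    hR0 F Φ s hF hdF hΦ1 hs
  have hFAR : SI FAR isq ≤ kF * DΦ := by
    calc SI FAR isq ≤ SI FAR (fun u y ↦ kF * iB u y) := by
          refine slab_lintegral_mono_fun mFAR fun u y hy ↦ ?_
          simp only [hFAR, Set.mem_setOf_eq] at hy
          have hr := hrad u y
          exact ofReal_le_mul (by positivity) (hP4 _ (by rw [hr]; exact hy.1) (by rw [hr]; exact hy.2))
      _ = kF * SI FAR iB := slab_lintegral_const_mul _ ENNReal.ofReal_ne_top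
      _ ≤ kF * DΦ := by rw [eDΦ]; exact mul_le_mul_right (slab_lintegral_mono_set iB sub_FAR_Ω) _
  have hirs : SI Ω9 irs ≤ kp * DΦ := by
    calc SI Ω9 irs ≤ SI Ω9 (fun u y ↦ kp * iB u y) := by
          refine slab_lintegral_mono_fun mΩ9 fun u y hy ↦ ?_
          simp only [hΩ9, Set.mem_setOf_eq] at hy
          have hr := hrad u y
          exact ofReal_le_mul hKP0 (hP2 _ (by rw [hr]; exact hy.1) (by rw [hr]; exact hy.2.trans hRz9))
      _ = kp * SI Ω9 iB := slab_lintegral_const_mul _ ENNReal.ofReal_ne_top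
      _ ≤ kp * DΦ := by rw [eDΦ]; exact mul_le_mul_right (slab_lintegral_mono_set iB sub_Ω9_Ω) _
  have hCOLe' : SI COL ie = COLe := eCOLe.symm
  have hY : SI Ω9 ig ≤ CY * RHS := by
    calc SI Ω9 ig ≤ SI Ω9 ie := slab_lintegral_mono_fun mΩ9 fun u y _ ↦
            ENNReal.ofReal_le_ofReal (pw_g_le_e _)
      _ ≤ SI (COL ∪ (OFF ∪ PS)) ie := slab_lintegral_mono_set ie Ω9_sub
      _ ≤ SI COL ie + SI (OFF ∪ PS) ie := slab_lintegral_union_le _ _ mie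
      _ ≤ SI COL ie + (SI OFF ie + SI PS ie) := add_le_add le_rfl (slab_lintegral_union_le _ _ mie)
      _ ≤ COLe + (kp * DΦ + C9 * RHS) := add_le_add hCOLe'.le (add_le_add hOFF h9')
      _ ≤ RHS + (kp * RHS + C9 * RHS) := add_le_add aCOL (add_le_add (mul_le_mul_right aDΦ _) le_rfl)
      _ = CY * RHS := by simp only [hCY]; ring
  have hsumZ : SI Ω9 (fun u y ↦ ENNReal.ofReal (frs Φ (L u y) + fg (L u y))) ≤ kp * DΦ + CY * RHS := by
    calc SI Ω9 (fun u y ↦ ENNReal.ofReal (frs Φ (L u y) + fg (L u y)))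
          ≤ SI Ω9 (fun u y ↦ irs u y + ig u y) :=
          slab_lintegral_mono_fun mΩ9 fun u y _ ↦ ENNReal.ofReal_add_le
      _ = SI Ω9 irs + SI Ω9 ig := slab_lintegral_add_right _ mig
      _ ≤ kp * DΦ + CY * RHS := add_le_add hirs hY
  have hZ : SI Zs isq ≤ CZ * RHS := by
    calc SI Zs isq ≤ _ := h0'
      _ ≤ (K₀ : ℝ≥0∞) * (m * P0 + m * Ps + kF * DΦ + m2 * (kp * DΦ + CY * RHS)) :=
          mul_le_mul_right (add_le_add (add_le_add (add_le_add le_rfl le_rfl) hFAR)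
            (mul_le_mul_right hsumZ _)) _
      _ ≤ (K₀ : ℝ≥0∞) * (m * RHS + m * RHS + kF * RHS + m2 * (kp * RHS + CY * RHS)) :=
          mul_le_mul_right (add_le_add (add_le_add (add_le_add (mul_le_mul_right aP0 _)
            (mul_le_mul_right aPs _)) (mul_le_mul_right aDΦ _))
            (mul_le_mul_right (add_le_add (mul_le_mul_right aDΦ _) le_rfl) _)) _
      _ = CZ * RHS := by simp only [hCZ]; ring
  -- ### (5) zeroth order on `[15M/2, R_z]`
  have hFARz : SI FARz isq ≤ kZ * DΦ := by
    calc SI FARz isq ≤ SI FARz (fun u y ↦ kZ * iB u y) := by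
          refine slab_lintegral_mono_fun mFARz fun u y hy ↦ ?_
          simp only [hFARz, Set.mem_setOf_eq] at hy
          have hr := hrad u y
          exact ofReal_le_mul (by positivity) (hfar _ (by rw [hr]; exact hy.1) (by rw [hr]; exact hy.2))
      _ = kZ * SI FARz iB := slab_lintegral_const_mul _ ENNReal.ofReal_ne_top
      _ ≤ kZ * DΦ := by rw [eDΦ]; exact mul_le_mul_right (slab_lintegral_mono_set iB sub_FARz_Ω) _
  -- ### (6) the zeroth-order part of the claim
  have hzero : SI ZR (fun u y ↦ ENNReal.ofReal (Φ (L u y) ^ 2 / M ^ 2)) ≤ mi2 * (CZ + kZ) * RHS := by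
    calc SI ZR (fun u y ↦ ENNReal.ofReal (Φ (L u y) ^ 2 / M ^ 2))
          = SI ZR (fun u y ↦ mi2 * isq u y) := by
          simp only [hSI, hisq, hfsq, hmi2, div_eq_inv_mul]
          congr 1; funext u; congr 1; funext y
          rw [ENNReal.ofReal_mul (inv_nonneg.mpr (by positivity))]
      _ = mi2 * SI ZR isq := slab_lintegral_const_mul _ ENNReal.ofReal_ne_top
      _ ≤ mi2 * SI (Zs ∪ FARz) isq := mul_le_mul_right (slab_lintegral_mono_set isq ZR_sub) _
      _ ≤ mi2 * (SI Zs isq + SI FARz isq) :=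
          mul_le_mul_right (slab_lintegral_union_le _ _ (meas_of ((hΦ.continuous).pow 2))) _
      _ ≤ mi2 * (CZ * RHS + kZ * DΦ) := mul_le_mul_right (add_le_add hZ hFARz) _
      _ ≤ mi2 * (CZ * RHS + kZ * RHS) := mul_le_mul_right (add_le_add le_rfl (mul_le_mul_right aDΦ _)) _
      _ = mi2 * (CZ + kZ) * RHS := by ring
  -- ### conclusion
  calc SI AW ie + SI ZR (fun u y ↦ ENNReal.ofReal (Φ (L u y) ^ 2 / M ^ 2))
      ≤ (C9 + kp) * RHS + mi2 * (CZ + kZ) * RHS := add_le_add hgrad hzero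
    _ = Ktot * RHS := by simp only [hKtot]; ring

end Summit.FinalStateConjecture.FinalStateConjecture.Theorems
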